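import Summits.Ventures.QEC.CircuitDistance.PortK2DataBB144Z
import Summits.Ventures.QEC.CircuitDistance.K2Chunks
import HarnessLib

/-!
# K2(`[[144,12,12]]`) chunk module — COMPUTATIONAL (native_decide; `Lean.ofReduceBool`)

Cell `qec`, CDX, R146/R152 STEP 1 («computational» header; `ofReduceBool` confined to these chunk modules). Checker of record
`K2.K2Data` (qec-cdx-type-1, PortK2Check); data module of record `PortK2DataBB144X/Z` (p669158/9, crit-1 data audit PASS
2026-08-28T21:20Z); chunk glue `K2Chunks` (idea-1 g2). Cube 0, child 17: leaf group 4 of 6.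
Leaf theorems: the K2 DFS accepts below one descendant state of pivot cube 0 (sector Z); sizes are exact DFS visit counts
(eng-1 g2 `k2count.c`), capped so that the gate's native-axiom audit re-verifies every leaf in place. Assemblies re-derive the
child lists in the kernel (`decide`) and end in the literal cube fact `d144Z.cube (Ts144Z.getD 0 []) (0) (lives144Z.getD 0 0) = true`
(the `hcubes` hypothesis of `K2Inst.k2_complete`). Emitted by qec-cdx-eng-1 g2 (`gen2.py`, idea-1's `gen_k2chunks_from_lean.py` lineage).
-/

namespace Summit.Ventures.QEC.CircuitDistance.K2

set_option maxRecDepth 100000 in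
set_option maxHeartbeats 0 in
set_option exponentiation.threshold 1024 in
/-- K2(144) chunk fact `cube144Z0_ch17_8` (608375 DFS visits; see the module docstring). -/
theorem cube144Z0_ch17_8 : app5 (d144Z.dfs (Ts144Z.getD 0 []) 6) (890082423154252189888, 840, 1018517988167243043134222844204689080525757580859165419764761483634514110409982848012386305, 3, 2348542582773833226868973315676453000151452285808832867677198495982726747623850032053991240906250453646311388) = true := by native_decide

set_option maxRecDepth 100000 in
set_option maxHeartbeats 0 in
set_option exponentiation.threshold 1024 in
/-- K2(144) chunk fact `cube144Z0_ch17_9` (427636 DFS visits; see the module docstring). -/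
theorem cube144Z0_ch17_9 : app5 (d144Z.dfs (Ts144Z.getD 0 []) 6) (2951506073391311389056, 1480, 1018517988167243043134222844204689080537706818245982882023994810826802440378689752483758081, 3, 2348542582773833226868973315676453000151452285808832867665225874569711990917925445904379450409229054254251996) = true := by native_decide

set_option maxRecDepth 100000 in
set_option maxHeartbeats 0 in
set_option exponentiation.threshold 1024 in
/-- K2(144) chunk fact `cube144Z0_ch17_10` (338144 DFS visits; see the module docstring). -/
theorem cube144Z0_ch17_10 : app5 (d144Z.dfs (Ts144Z.getD 0 []) 6) (590322831957679949952, 3528, 1018517988167243043134222844204689081291981967265912554497243738252345241691037914183499777, 3, 2348542582773833226868973315676453000151452285808832866898978104136767561738751932329224858599859493162450908) = true := by native_decide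

set_option maxRecDepth 100000 in
set_option maxHeartbeats 0 in
set_option exponentiation.threshold 1024 in
/-- K2(144) chunk fact `cube144Z0_ch17_11` (398239 DFS visits; see the module docstring). -/
theorem cube144Z0_ch17_11 : app5 (d144Z.dfs (Ts144Z.getD 0 []) 6) (740204914539545755776, 832, 1018517988167243043134223686703022428983227780177189594681528775837953854274558387579518977, 3, 2348542582773833226868973315676453000151451443310499518441484520792546092375293381168461654206969458674630620) = true := by native_decide
end Summit.Ventures.QEC.CircuitDistance.K2
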